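import Literature.MeasureTheory.RestrictedProduct.QuotientMeasure
import Literature.MeasureTheory.RestrictedProduct.Haar
import Literature.MeasureTheory.Group.InvariantQuotientNormalized
import Literature.Topology.Algebra.RestrictedProduct.Cutout
import HarnessLib

/-!
# Restricted product measures, XIII: the restricted product of the local QUOTIENT measures IS the quotient measure of the
# restricted products — `∏'_i (ν_i ∕ t_i) = (∏'_i ν_i) ∕ (∏'_i t_i)` on `(Πʳ_i G_i) ⧸ (Πʳ_i H_i) = Πʳ_i (G_i ⧸ H_i)`, constant ONE
(Tate, in Cassels–Fröhlich (1967) Ch. XV §3.3: `dα = ∏ dα_𝔭`; Folland (1995) §2.6 Thm. 2.49 ∕ (2.52): Weil's formula; Rogawski (1990)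
§5.4 p. 72: `Φ(γ, ⊗ f_v) = ∏_v Φ(γ_v, f_v)` «with `dg = ⊗ dg_v`, `dt = ⊗ dt_v`»; Gelbart (1975) p. 155 (10.19))

Topic `MeasureTheory/RestrictedProduct`; THEOREMS ONLY (no definition, no instance, no named fact).  ★ `QuotientMeasure` (XI) builds, from
local measures `m_i` on the coset spaces `G_i ⧸ H_i` normalised by `m_i(π_i K_i) = 1` off a finite `S₀`, the invariant measure
`μ_Q := (∏'_i (m_i ; π_i K_i)).map (quotientHomeomorph)⁻¹` on `(Πʳ_i G_i) ⧸ M`, `M = {y | ∀ i, y_i ∈ H_i}`; ★ `OrbitalEulerProduct` (XII) shows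
EVERY invariant measure there is `c • μ_Q` for SOME `c`.  The tree's canonical quotient measures `quotientMeasure H ρ ν = ν ∕ ρ` (Weil constant
ONE, ★ `InvariantQuotientExistence` ∕ `InvariantQuotientNormalized`) have finite-product and binary-product compatibilities with constant one
(★ `InvariantQuotientPiNormalized`, ★ `InvariantQuotientProdNormalized`); this file is the RESTRICTED-PRODUCT compatibility:

* `rpMeasure_setOf_forall_mem_eq_prod` — book-keeping: the restricted product measure of a «box with finitely many modified factors»
  `{x | ∀ i, x_i ∈ A_i}`, `A_i = C_i` off `S ⊇ S₀`, is `∏_{i∈S} m_i(A_i)`;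
* `isClosed_cutout` — `M = cutout K H` is closed when the `H_i` are;
* `fiberLIntegral_indicator_rpBox_mk_eq_prod` — the fibre integral of the integral box `𝟙_{A_∅}` (`A_∅ = {x | ∀ i, x_i ∈ K_i}`) along `M`,
  for the restricted-product measure `t_M = ∏'_i (t_i ; H_i ∩ K_i)` on `M ≅ Πʳ_i H_i` (★ `Cutout.cutoutEquiv`), FACTORISES into the local fibre
  integrals of `𝟙_{K_i}`;
* **`map_quotientHomeomorph_symm_rpMeasure_quotientMeasure_eq_quotientMeasure`** — for Haar measures `ν_i` on `G_i` (`ν_i(K_i) = 1` off `S₀`)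
  and Haar-type measures `t_i` on the closed subgroups `H_i` (`t_i(H_i ∩ K_i) = 1` off `S₀`), with `m_i := ν_i ∕ t_i = quotientMeasure (H i) (t i) (ν i)`
  and `m_i(π_i K_i) = 1` off `S₀` (a hypothesis here — it is `ν_i(K_i) ∕ t_i(H_i ∩ K_i)`, the «compact-open mass» computation): the measure
  `μ_Q` built from the local quotient measures EQUALS the quotient measure `ν' ∕ t_M` of the restricted-product Haar measure
  `ν' = ∏'_i (ν_i ; K_i)` by the restricted-product measure `t_M` — Weil constant ONE.  Proof: `μ_Q` is invariant and finite on compacta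
  (★ XI), hence `c • (ν' ∕ t_M)` with `c` its unfolding constant (★ `eq_unfoldingConstant_smul_quotientMeasure`); Weil's lift of `μ_Q`
  evaluated on the integral box gives `∏_{i∈S₀} ν_i(K_i) = ν'(A_∅)` (the factorisation above + the Euler product ★
  `lintegral_map_quotientHomeomorph_symm_eq_prod` + the LOCAL Weil formulas with constant one), so `c = 1`.

WHY (consumer).  The F0/P3a line's `ofLocal` adelic orbital measures (★ `orbitalMeasureOfLocal` ∕ `UnitaryGroup.adelicOrbitalMeasureOfLocal`)
are `μ_Q` read through models; with canonical local families `m_v = dg_v ∕ dt_v` this theorem identifies them with `dg ∕ dt` for the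
restricted-product Haar measures — the currency in which the orbital weights are covolumes `m(T(F) \ T(𝔸))` (★ `UnitaryGroupDiagTraceNormalized`,
★ `LatticeCovolumeTransport`), i.e. the measure-theoretic content of «β constant on stable classes».

## References
* J. W. S. Cassels, A. Fröhlich (eds.), *Algebraic Number Theory* (1967), Ch. XV (Tate) §3.3 [CasselsFrohlichANT1967].
* G. B. Folland, *A Course in Abstract Harmonic Analysis* (1995), §2.6 Thm. 2.49, (2.52) [Folland1995].
* J. D. Rogawski, *Automorphic Representations of Unitary Groups in Three Variables* (1990), §4.3 p. 44, §5.4 p. 72 [Rogawski1990].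
-/

set_option autoImplicit false

noncomputable section

open _root_.MeasureTheory _root_.MeasureTheory.Measure Set Filter Function
open _root_.Topology
open Literature.Topology.RestrictedProduct Literature.Topology.Algebra.RestrictedProduct Literature.MeasureTheory.Group
open scoped RestrictedProduct ENNReal NNReal Pointwise

namespace Literature.MeasureTheory.RestrictedProduct

universe u v

/-! ## §0 Book-keeping: boxes with finitely many modified factors -/

section Box

variable {ι : Type u} [Countable ι] {X : ι → Type v} [∀ i, MeasurableSpace (X i)]
  (C : ∀ i, Set (X i)) (m : ∀ i, Measure (X i)) [∀ i, SigmaFinite (m i)]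

/-- Coordinate evaluation on the restricted product is measurable (trace σ-algebra). [cite: CasselsFrohlichANT1967, Ch. XV (Tate) §3.3] -/
theorem measurable_apply_rp (hCm : ∀ i, MeasurableSet (C i)) (i : ι) : Measurable fun x : Πʳ i, [X i, C i] => x i :=
  (measurable_pi_apply i).comp (measurable_incl C hCm)

/-- A «box with finitely many modified factors» is measurable. [cite: CasselsFrohlichANT1967, Ch. XV (Tate) §3.3] -/
theorem measurableSet_setOf_forall_mem (hCm : ∀ i, MeasurableSet (C i)) {A : ∀ i, Set (X i)} (hA : ∀ i, MeasurableSet (A i)) :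
    MeasurableSet {x : Πʳ i, [X i, C i] | ∀ i, x i ∈ A i} := by
  have h : {x : Πʳ i, [X i, C i] | ∀ i, x i ∈ A i} = ⋂ i, (fun x : Πʳ i, [X i, C i] => x i) ⁻¹' A i := by
    ext x; simp only [mem_setOf_eq, mem_iInter, mem_preimage]
  rw [h]
  exact MeasurableSet.iInter fun i => measurable_apply_rp C hCm i (hA i)

/-- **The restricted product measure of a box with finitely many modified factors**: if `A_i = C_i` off a finite `S ⊇ S₀` (and the `m_i`
give mass one to `C_i` off `S₀`), then `∏'_i (m_i ; C_i) {x | ∀ i, x_i ∈ A_i} = ∏_{i∈S} m_i(A_i)` (Tate's product formula on the cylinder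
`A_S`). [cite: CasselsFrohlichANT1967, Ch. XV (Tate) §3.3] -/
theorem rpMeasure_setOf_forall_mem_eq_prod (hCne : ∀ i, (C i).Nonempty) (hCm : ∀ i, MeasurableSet (C i)) {S₀ : Finset ι}
    (hm1 : ∀ i, i ∉ S₀ → m i (C i) = 1) {S : Finset ι} (hS : S₀ ⊆ S) {A : ∀ i, Set (X i)} (hA : ∀ i, MeasurableSet (A i))
    (hAC : ∀ i, i ∉ S → A i = C i) :
    rpMeasure C m S₀ {x : Πʳ i, [X i, C i] | ∀ i, x i ∈ A i} = ∏ i ∈ S, m i (A i) := by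
  classical
  haveI := isProbabilityMeasure_rho C m hCne hCm S
  have hsub : {x : Πʳ i, [X i, C i] | ∀ i, x i ∈ A i} ⊆ rpBox C S := fun x hx i hi => by
    have := hx i
    rwa [hAC i hi] at this
  have hpre : glue C S ⁻¹' {x : Πʳ i, [X i, C i] | ∀ i, x i ∈ A i} =
      (univ.pi fun i : {i // i ∈ S} => A i) ×ˢ univ := by
    ext p
    simp only [mem_preimage, mem_setOf_eq, mem_prod, mem_univ_pi, mem_univ, and_true]
    constructor
    · intro h j
      have := h j
      rwa [glue_apply_of_mem C S p j.2] at this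
    · intro h i
      by_cases hi : i ∈ S
      · rw [glue_apply_of_mem C S p hi]; exact h ⟨i, hi⟩
      · rw [glue_apply_of_not_mem C S p hi, hAC i hi]; exact (p.2 ⟨i, hi⟩).2
  rw [← inter_eq_left.2 hsub, ← Measure.restrict_apply' (measurableSet_rpBox _ hCm S),
    rpMeasure_restrict_rpBox _ m hCne hCm hm1 hS,
    Measure.map_apply (measurable_glue _ hCm S) (measurableSet_setOf_forall_mem C hCm hA), hpre,
    Measure.prod_prod, measure_univ, mul_one, Measure.pi_pi, Finset.prod_coe_sort S (fun i => m i (A i))]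

end Box

/-! ## §1 The subgroup `M = cutout K H` and the restricted-product measure on it -/

section Cutout

variable {ι : Type u} {G : ι → Type v} [∀ i, Group (G i)] [∀ i, TopologicalSpace (G i)]
  (K : ∀ i, Subgroup (G i)) (H : ∀ i, Subgroup (G i)) [hKo : Fact (∀ i, IsOpen (K i : Set (G i)))]

omit hKo in
/-- `cutout K H = {y | ∀ i, y_i ∈ H_i}` is closed when every `H_i` is (book-keeping for the quotient measure).
[cite: CasselsFrohlichANT1967, Ch. XV (Tate) §3.3] -/
theorem isClosed_cutout (hH : ∀ i, IsClosed (H i : Set (G i))) : IsClosed ((cutout K H : Subgroup (Πʳ i, [G i, K i])) : Set (Πʳ i, [G i, K i])) := by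
  have h : ((cutout K H : Subgroup (Πʳ i, [G i, K i])) : Set (Πʳ i, [G i, K i])) = ⋂ i, (fun x : Πʳ i, [G i, K i] => x i) ⁻¹' (H i : Set (G i)) := by
    ext x
    simp only [SetLike.mem_coe, mem_cutout_iff, mem_iInter, mem_preimage]
  rw [h]
  exact isClosed_iInter fun i => (hH i).preimage (RestrictedProduct.continuous_eval i)

omit [∀ i, TopologicalSpace (G i)] hKo in
/-- The membership characterisation of `cutout K H` in the shape `quotientHomeomorph` consumes. [cite: BorelJacquet1979, §4.1] -/
theorem mem_cutout_iff' : ∀ x : Πʳ i, [G i, K i], x ∈ cutout K H ↔ ∀ i, x i ∈ H i := fun _ => mem_cutout_iff K H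

end Cutout

/-! ## §2 The fibre integral of the integral box along `M` factorises -/

section Fiber

variable {ι : Type u} [Countable ι] {G : ι → Type v} [∀ i, Group (G i)] [∀ i, TopologicalSpace (G i)]
  [∀ i, IsTopologicalGroup (G i)] [∀ i, SecondCountableTopology (G i)] [∀ i, T2Space (G i)]
  [∀ i, MeasurableSpace (G i)] [∀ i, BorelSpace (G i)]
  (K : ∀ i, Subgroup (G i)) (H : ∀ i, Subgroup (G i)) [hKo : Fact (∀ i, IsOpen (K i : Set (G i)))]
  [BorelSpace (Πʳ i, [G i, K i])]
  (t : ∀ i, Measure (H i)) [∀ i, SigmaFinite (t i)] [∀ i, (t i).IsMulLeftInvariant]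
  (S₀ : Finset ι)
  (ρ : Measure (cutout K H : Subgroup (Πʳ i, [G i, K i]))) [ρ.IsMulLeftInvariant]

omit [Countable ι] [∀ i, SecondCountableTopology (G i)] [∀ i, T2Space (G i)] [BorelSpace (Πʳ i, [G i, K i])] in
/-- The local sets `A_i(g) = {h ∈ H_i | g h ∈ K_i}` are measurable. [cite: CasselsFrohlichANT1967, Ch. XV (Tate) §3.3] -/
theorem measurableSet_setOf_mul_mem (i : ι) (g : G i) : MeasurableSet {h : H i | g * (h : G i) ∈ (K i : Set (G i))} :=
  ((hKo.out i).preimage ((continuous_const.mul continuous_subtype_val))).measurableSet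

omit [Countable ι] [∀ i, TopologicalSpace (G i)] [∀ i, IsTopologicalGroup (G i)] [∀ i, SecondCountableTopology (G i)]
  [∀ i, T2Space (G i)] [∀ i, MeasurableSpace (G i)] [∀ i, BorelSpace (G i)] hKo [BorelSpace (Πʳ i, [G i, K i])] in
/-- For `g ∈ K_i`, `A_i(g) = H_i ∩ K_i` (as a subset of `H_i`). [cite: CasselsFrohlichANT1967, Ch. XV (Tate) §3.3] -/
theorem setOf_mul_mem_eq_of_mem (i : ι) {g : G i} (hg : g ∈ K i) :
    {h : H i | g * (h : G i) ∈ (K i : Set (G i))} = ((inH K H i : Subgroup (H i)) : Set (H i)) := by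
  ext h
  simp only [mem_setOf_eq, SetLike.mem_coe, Subgroup.mem_subgroupOf]
  exact ⟨fun hh => by simpa using (K i).mul_mem ((K i).inv_mem hg) hh, fun hh => (K i).mul_mem hg hh⟩

omit [Countable ι] [∀ i, SecondCountableTopology (G i)] [∀ i, T2Space (G i)] [BorelSpace (Πʳ i, [G i, K i])]
  [∀ i, SigmaFinite (t i)] in
/-- The local fibre integral of `𝟙_{K_i}` at `g H_i` is `t_i(A_i(g))`. [cite: Folland1995, §2.6 Thm. 2.49] -/
theorem fiberLIntegral_indicator_mk_eq (i : ι) (g : G i) :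
    fiberLIntegral (H i) (t i) ((K i : Set (G i)).indicator 1) (QuotientGroup.mk g) = t i {h : H i | g * (h : G i) ∈ (K i : Set (G i))} := by
  rw [fiberLIntegral_mk]
  have h1 : (fun h : H i => (K i : Set (G i)).indicator (1 : G i → ℝ≥0∞) (g * (h : G i))) =
      {h : H i | g * (h : G i) ∈ (K i : Set (G i))}.indicator 1 := by
    funext h
    by_cases hh : g * (h : G i) ∈ (K i : Set (G i))
    · rw [indicator_of_mem hh, indicator_of_mem (show h ∈ {h : H i | g * (h : G i) ∈ (K i : Set (G i))} from hh)]; rfl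
    · rw [indicator_of_notMem hh, indicator_of_notMem (show h ∉ {h : H i | g * (h : G i) ∈ (K i : Set (G i))} from hh)]
  rw [h1, lintegral_indicator_one (measurableSet_setOf_mul_mem K H i g)]

omit [∀ i, T2Space (G i)] [∀ i, (t i).IsMulLeftInvariant] in
/-- **The fibre integral of the integral box factorises**: for `t_M = (∏'_i (t_i ; H_i ∩ K_i)).map cutoutEquiv` (normalised
`t_i(H_i ∩ K_i) = 1` off `S₀`) and `x ∈ Πʳ G_i` with `x_i ∈ K_i` off `S ⊇ S₀`:
`∫_{M} 𝟙_{A_∅}(x m) dt_M(m) = ∏_{i∈S} t_i(A_i(x_i))`, `A_∅ = {y | ∀ i, y_i ∈ K_i}`. [cite: CasselsFrohlichANT1967, Ch. XV (Tate) §3.3] -/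
theorem fiberLIntegral_indicator_rpBox_mk_eq_prod
    (hρ : ρ = Measure.map (cutoutEquiv K H) (rpMeasure (fun i => ((inH K H i : Subgroup (H i)) : Set (H i))) t S₀))
    (ht1 : ∀ i, i ∉ S₀ → t i ((inH K H i : Subgroup (H i)) : Set (H i)) = 1)
    {S : Finset ι} (hS : S₀ ⊆ S) (x : Πʳ i, [G i, K i]) (hx : ∀ i, i ∉ S → x i ∈ (K i : Set (G i))) :
    fiberLIntegral (cutout K H) ρ ((rpBox (fun i => (K i : Set (G i))) ∅).indicator 1) (QuotientGroup.mk x) =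
      ∏ i ∈ S, t i {h : H i | x i * (h : G i) ∈ (K i : Set (G i))} := by
  -- the set of `m ∈ M` with `x m` in the integral box
  have hKm : ∀ i, MeasurableSet (K i : Set (G i)) := fun i => (hKo.out i).measurableSet
  set E : Set (cutout K H : Subgroup (Πʳ i, [G i, K i])) :=
    {m | ∀ i, x i * (((m : Πʳ i, [G i, K i]) i : G i)) ∈ (K i : Set (G i))} with hE
  have h1 : (fun m : (cutout K H : Subgroup (Πʳ i, [G i, K i])) =>
      (rpBox (fun i => (K i : Set (G i))) ∅).indicator (1 : (Πʳ i, [G i, K i]) → ℝ≥0∞) (x * (m : Πʳ i, [G i, K i]))) = E.indicator 1 := by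
    funext m
    have hiff : x * (m : Πʳ i, [G i, K i]) ∈ rpBox (fun i => (K i : Set (G i))) ∅ ↔ m ∈ E := by
      simp only [rpBox, Finset.notMem_empty, not_false_eq_true, forall_true_left, mem_setOf_eq, hE,
        RestrictedProduct.mul_apply]
    by_cases hm : m ∈ E
    · rw [indicator_of_mem (hiff.2 hm), indicator_of_mem hm]; rfl
    · rw [indicator_of_notMem (fun h => hm (hiff.1 h)), indicator_of_notMem hm]
  -- `E` is measurable (continuity of evaluation and multiplication)
  have hEm : MeasurableSet E := by
    have hE' : E = ⋂ i, (fun m : (cutout K H : Subgroup (Πʳ i, [G i, K i])) => x i * ((m : Πʳ i, [G i, K i]) i)) ⁻¹' (K i : Set (G i)) := by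
      ext m; simp only [hE, mem_setOf_eq, mem_iInter, mem_preimage]
    rw [hE']
    refine MeasurableSet.iInter fun i => ?_
    have hc : Continuous fun m : (cutout K H : Subgroup (Πʳ i, [G i, K i])) => x i * ((m : Πʳ i, [G i, K i]) i) :=
      continuous_const.mul ((RestrictedProduct.continuous_eval i).comp continuous_subtype_val)
    exact (hKo.out i).preimage hc |>.measurableSet
  rw [fiberLIntegral_mk, h1, lintegral_indicator_one hEm, hρ,
    Measure.map_apply (by
      haveI : BorelSpace (Πʳ i, [H i, inH K H i]) :=
        borelSpace (fun i => ((inH K H i : Subgroup (H i)) : Set (H i))) (fun i => (isOpen_inH K H hKo.out i).measurableSet)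
      exact (cutoutEquiv K H).continuous.measurable) hEm]
  -- the preimage under `cutoutEquiv` is a box with modified factors at `S`
  have hpre : (cutoutEquiv K H) ⁻¹' E = {y : Πʳ i, [H i, inH K H i] | ∀ i, y i ∈ {h : H i | x i * (h : G i) ∈ (K i : Set (G i))}} := by
    ext y
    simp only [hE, mem_preimage, mem_setOf_eq, coe_cutoutEquiv_apply]
  rw [hpre]
  exact rpMeasure_setOf_forall_mem_eq_prod (fun i => ((inH K H i : Subgroup (H i)) : Set (H i))) t
    (fun i => ⟨1, (inH K H i).one_mem⟩) (fun i => (isOpen_inH K H hKo.out i).measurableSet) ht1 hS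
    (fun i => measurableSet_setOf_mul_mem K H i (x i)) (fun i hi => setOf_mul_mem_eq_of_mem K H i (hx i hi))

end Fiber

/-! ## §3 The identification with Weil constant one -/

section Main

variable {ι : Type u} [Countable ι] {G : ι → Type v} [∀ i, Group (G i)] [∀ i, TopologicalSpace (G i)]
  [∀ i, IsTopologicalGroup (G i)] [∀ i, LocallyCompactSpace (G i)] [∀ i, SecondCountableTopology (G i)] [∀ i, T2Space (G i)]
  [∀ i, MeasurableSpace (G i)] [∀ i, BorelSpace (G i)]
  (K : ∀ i, Subgroup (G i)) (H : ∀ i, Subgroup (G i)) [hKo : Fact (∀ i, IsOpen (K i : Set (G i)))]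
  [hKc : ∀ i, CompactSpace (K i)] [hH : ∀ i, IsClosed ((H i : Subgroup (G i)) : Set (G i))]
  [BorelSpace (Πʳ i, [G i, K i])] [SecondCountableTopology (Πʳ i, [G i, K i])]
  [∀ i, MeasurableSpace (G i ⧸ H i)] [∀ i, BorelSpace (G i ⧸ H i)] [∀ i, SecondCountableTopology (G i ⧸ H i)]
  [MeasurableSpace ((Πʳ i, [G i, K i]) ⧸ (cutout K H : Subgroup (Πʳ i, [G i, K i])))]
  [BorelSpace ((Πʳ i, [G i, K i]) ⧸ (cutout K H : Subgroup (Πʳ i, [G i, K i])))]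
  (ν : ∀ i, Measure (G i)) [∀ i, IsHaarMeasure (ν i)] [∀ i, (ν i).IsMulRightInvariant]
  (t : ∀ i, Measure (H i)) [∀ i, (t i).IsMulLeftInvariant] [∀ i, IsFiniteMeasureOnCompacts (t i)]
  [∀ i, (t i).IsOpenPosMeasure] [∀ i, (t i).IsInvInvariant] [∀ i, SFinite (t i)] [∀ i, SigmaFinite (t i)]
  (S₀ : Finset ι)
  (ν' : Measure (Πʳ i, [G i, K i])) [IsHaarMeasure ν'] [ν'.IsMulRightInvariant]
  (ρ : Measure (cutout K H : Subgroup (Πʳ i, [G i, K i]))) [ρ.IsMulLeftInvariant] [IsFiniteMeasureOnCompacts ρ]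
  [ρ.IsOpenPosMeasure] [ρ.IsInvInvariant] [SFinite ρ]

/-- **The restricted product of the local quotient measures is the quotient measure of the restricted products, Weil constant ONE.**
Setting: locally compact second countable groups `G_i` with compact open subgroups `K_i`, closed subgroups `H_i`; Haar measures `ν_i`
(`ν_i(K_i) = 1` off `S₀`), Haar-type measures `t_i` on `H_i` (`t_i(H_i ∩ K_i) = 1` off `S₀`); the local quotient measures
`m_i = quotientMeasure (H i) (t i) (ν i) = ν_i ∕ t_i` with `m_i(π_i K_i) = 1` off `S₀` (hypothesis `hm1`; it is the compact-open mass
`ν_i(K_i) ∕ t_i(H_i ∩ K_i)`); the restricted-product Haar measure `ν' = ∏'_i (ν_i ; K_i)` on `Πʳ G_i` and `t_M = (∏'_i (t_i ; H_i ∩ K_i)).map cutoutEquiv`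
on `M = cutout K H` (hypotheses `hν'`, `hρ`; Haar by ★ `isHaarMeasure_rpMeasure`).  Then

  `(∏'_i (m_i ; π_i K_i)).map quotientHomeomorph⁻¹ = quotientMeasure M t_M ν'`   on `(Πʳ_i G_i) ⧸ M`

— `∏'(ν_i ∕ t_i) = (∏' ν_i) ∕ (∏' t_i)`, no constant (Tate's `dα = ∏ dα_𝔭` for the coset spaces; the `dg = ⊗ dg_v`, `dt = ⊗ dt_v` convention behind
Rogawski's `Φ(γ, ⊗ f_v) = ∏_v Φ(γ_v, f_v)`). [cite: CasselsFrohlichANT1967, Ch. XV (Tate) §3.3] -/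
theorem map_quotientHomeomorph_symm_rpMeasure_quotientMeasure_eq_quotientMeasure
    (hν1 : ∀ i, i ∉ S₀ → ν i (K i : Set (G i)) = 1)
    (ht1 : ∀ i, i ∉ S₀ → t i ((inH K H i : Subgroup (H i)) : Set (H i)) = 1)
    (hm1 : ∀ i, i ∉ S₀ → quotientMeasure (H i) (t i) (hH i) (ν i) (quotBase K H i) = 1)
    (hν' : ν' = rpMeasure (fun i => (K i : Set (G i))) ν S₀)
    (hρ : ρ = Measure.map (cutoutEquiv K H) (rpMeasure (fun i => ((inH K H i : Subgroup (H i)) : Set (H i))) t S₀)) :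
    (rpMeasure (fun i => quotBase K H i) (fun i => quotientMeasure (H i) (t i) (hH i) (ν i)) S₀).map
        (quotientHomeomorph K H (cutout K H) (mem_cutout_iff' K H) hKo.out).symm =
      quotientMeasure (cutout K H) ρ (isClosed_cutout K H hH) ν' := by
  haveI hMc : IsClosed ((cutout K H : Subgroup (Πʳ i, [G i, K i])) : Set (Πʳ i, [G i, K i])) := isClosed_cutout K H hH
  have hKm : ∀ i, MeasurableSet (K i : Set (G i)) := fun i => (hKo.out i).measurableSet
  -- the local quotient measures are invariant, finite on compacta, σ-finite
  haveI : ∀ i, SMulInvariantMeasure (G i) (G i ⧸ H i) (quotientMeasure (H i) (t i) (hH i) (ν i)) := fun i =>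
    smulInvariantMeasure_quotientMeasure (H i) (t i) (hH i) (ν i)
  -- the transported restricted product `μ_Q` is invariant and finite on compacta
  set μQ := (rpMeasure (fun i => quotBase K H i) (fun i => quotientMeasure (H i) (t i) (hH i) (ν i)) S₀).map
    (quotientHomeomorph K H (cutout K H) (mem_cutout_iff' K H) hKo.out).symm with hμQ
  haveI : SMulInvariantMeasure (Πʳ i, [G i, K i]) ((Πʳ i, [G i, K i]) ⧸ (cutout K H : Subgroup (Πʳ i, [G i, K i]))) μQ :=
    smulInvariantMeasure_map_quotientHomeomorph_symm K H (cutout K H) (mem_cutout_iff' K H) _ S₀ hm1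
  haveI : IsFiniteMeasureOnCompacts μQ :=
    isFiniteMeasureOnCompacts_map_quotientHomeomorph_symm K H (cutout K H) (mem_cutout_iff' K H) _ S₀ hm1
  -- hence `μ_Q = c • (ν' ∕ t_M)`, `c` its unfolding constant
  have key := eq_unfoldingConstant_smul_quotientMeasure (cutout K H) ρ ν' μQ
  -- Weil's lift of `μ_Q` is `c • ν'`; evaluate it on the integral box `A_∅`
  have hlift := liftMeasure_eq_smul (cutout K H) ρ μQ ν'
  have hBm : MeasurableSet (rpBox (fun i => (K i : Set (G i))) ∅) := measurableSet_rpBox _ hKm ∅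
  -- the mass of the integral box for `ν'`
  have hνB : ν' (rpBox (fun i => (K i : Set (G i))) ∅) = ∏ i ∈ S₀, ν i (K i : Set (G i)) := by
    rw [hν']
    have h := rpMeasure_setOf_forall_mem_eq_prod (fun i => (K i : Set (G i))) ν (fun i => ⟨1, (K i).one_mem⟩) hKm hν1
      (Finset.Subset.refl S₀) (A := fun i => (K i : Set (G i))) hKm (fun i _ => rfl)
    have hset : {x : Πʳ i, [G i, K i] | ∀ i, x i ∈ (K i : Set (G i))} = rpBox (fun i => (K i : Set (G i))) ∅ := by
      ext x; simp only [rpBox, Finset.notMem_empty, not_false_eq_true, forall_true_left, mem_setOf_eq]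
    rw [← hset, h]
  have hP0 : (∏ i ∈ S₀, ν i (K i : Set (G i))) ≠ 0 :=
    Finset.prod_ne_zero_iff.2 fun i _ => ((hKo.out i).measure_pos (ν i) ⟨1, (K i).one_mem⟩).ne'
  have hPt : (∏ i ∈ S₀, ν i (K i : Set (G i))) ≠ ∞ :=
    ENNReal.prod_ne_top fun i _ => (isCompact_iff_compactSpace.2 (hKc i)).measure_lt_top.ne
  -- the mass of the integral box for the lift of `μ_Q`: `∏_{i∈S₀} ν_i(K_i)` as well
  have hliftB : liftMeasure (cutout K H) ρ μQ (rpBox (fun i => (K i : Set (G i))) ∅) = ∏ i ∈ S₀, ν i (K i : Set (G i)) := by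
    rw [liftMeasure_apply (cutout K H) ρ μQ hBm]
    -- the integrand factorises on the cylinders from `S₀` on, with local factors the fibre integrals of `𝟙_{K_i}`
    have hφm : ∀ i, Measurable (fiberLIntegral (H i) (t i) ((K i : Set (G i)).indicator 1)) := fun i =>
      measurable_fiberLIntegral (H i) (t i) (measurable_one.indicator (hKm i))
    have hF : ∀ S : Finset ι, S₀ ⊆ S → ∀ x : Πʳ i, [G i, K i], (∀ i, i ∉ S → x i ∈ (K i : Set (G i))) →
        fiberLIntegral (cutout K H) ρ ((rpBox (fun i => (K i : Set (G i))) ∅).indicator 1) (QuotientGroup.mk x) =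
          ∏ i ∈ S, fiberLIntegral (H i) (t i) ((K i : Set (G i)).indicator 1) ((x i : G i) : G i ⧸ H i) := by
      intro S hS x hx
      rw [fiberLIntegral_indicator_rpBox_mk_eq_prod K H t S₀ ρ hρ ht1 hS x hx]
      exact Finset.prod_congr rfl fun i _ => (fiberLIntegral_indicator_mk_eq K H t i (x i)).symm
    have hφ1 : ∀ i, i ∉ S₀ → ∫⁻ y, fiberLIntegral (H i) (t i) ((K i : Set (G i)).indicator 1) y ∂(quotientMeasure (H i) (t i) (hH i) (ν i)) = 1 := by
      intro i hi
      rw [lintegral_fiberLIntegral_quotientMeasure (H i) (t i) (ν i) (measurable_one.indicator (hKm i)),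
        lintegral_indicator_one (hKm i), hν1 i hi]
    rw [hμQ, lintegral_map_quotientHomeomorph_symm_eq_prod K H (cutout K H) (mem_cutout_iff' K H) _ S₀ hm1 _ hφm _ hF
      (Finset.Subset.refl S₀) hφ1]
    refine Finset.prod_congr rfl fun i _ => ?_
    rw [lintegral_fiberLIntegral_quotientMeasure (H i) (t i) (ν i) (measurable_one.indicator (hKm i)),
      lintegral_indicator_one (hKm i)]
  -- so `c = 1`
  have hc : unfoldingConstant (cutout K H) ρ μQ ν' = 1 := by
    have h := congrArg (fun μ : Measure (Πʳ i, [G i, K i]) => μ (rpBox (fun i => (K i : Set (G i))) ∅)) hlift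
    simp only [Measure.smul_apply, hliftB, hνB, ENNReal.smul_def, smul_eq_mul] at h
    -- `P = c • P` with `P ∈ (0, ∞)`
    have h' : ((unfoldingConstant (cutout K H) ρ μQ ν' : ℝ≥0∞)) * (∏ i ∈ S₀, ν i (K i : Set (G i))) =
        1 * ∏ i ∈ S₀, ν i (K i : Set (G i)) := by
      rw [one_mul]; exact h.symm
    exact ENNReal.coe_eq_one.1 ((ENNReal.mul_left_inj hP0 hPt).1 h')
  rw [key, hc, one_smul]

end Main

end Literature.MeasureTheory.RestrictedProduct
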